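import Summits.QuantumFields.YangMills.Theorems.BalabanUVNodesN15KingModelProp37AtRegularField
import Literature.MathematicalPhysics.QuantumFieldTheory.Balaban1983to89.B3Ineq212VectorTorus
import Literature.MathematicalPhysics.QuantumFieldTheory.Balaban1983to89.B1Ineq225BackgroundTorus

/-!
# N15 (NE2⁺, row s3 KING-MODEL ∕ RIEMANN-KERNEL RUNG) — PART Ζ-d: KING 1986 PROPOSITION 3.7 BY NAME AT A REGULAR BACKGROUND WITH ALL THREE
# DISPLAYS (3.63)–(3.65) INHABITED — the vector-field slice clause (3.64) filled in from [Ba3] (2.12) (lit-balaban `B3Ineq212VectorTorus`)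

count-neutral helper of the pub-ymgap K3⁸ programme (`--supports stmt-QuantumFields-27366`); nothing here is a claim about Bałaban's
non-abelian `G(U)`, the continuum, ℝ⁴, OS axioms, a mass gap or the Clay problem.  One finite torus `T_ε` at fixed `ε`.

## What is printed

[King1986] Prop. 3.7 p. 663 [PDF 15] has three displays: (3.63) sizes of the scalar slices `G^η_{(j)}` and `∂^ηG^η_{(j)}`, (3.64) the
vector-field slice with one leg averaged along the composite contour, *"|G^η_{(j)}(Γ^{(j+1)}_{x_{j+1},x}, b)| ≤ C(L^jη)^{3−d}exp[−δ₁(L^jη)^{−1}dist(B^j(x), b)],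
(3.64)"*, and (3.65) the Hölder lines; p. 656 (Thm 3.3): *"It implies the same bounds for the vector field operators (of course with A = 0)"*;
p. 665: *"Proposition 3.7 also holds for G^η_{(j)}(Ω′) and G^η_{(j)}(Ω′, A^{(k)})"*.  [Balaban1983Higgs3] (2.12) p. 426 is (3.64) verbatim for the
pieces of (I.2.43) of the VECTOR-field torus propagator (`N = d`, zero charge, mass `μ₀² > 0`) — PROVED in the tree on the general volume family by
lit-balaban (`B3Ineq212VectorTorus.ineq210_and_212_vectorTorus`, carrier `vecTorusKernels _ μ₀² a_v k`, `absGavg j x b = ε^{−d}|G^η_{(j)}(Γ^{(j+1)}_{x_{j+1},x}, b)|`).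

## What this file proves

* §1 `prop37PrintedAt_weaken` — on any `SliceKernels` datum with positive slices and non-negative distances, `Prop37PrintedAt α D C δ` is monotone
  (`C ↑`, `δ ↓ ≥ 0`).
* §2 def `kingSliceKernelsRegV S C A m² a k μ₀² a_v : SliceKernels P.d` — PART Ζ-b's datum at the regular background `A` with the bond type and
  the (3.64) field FILLED IN: `B = PBond P 0`, `distBlockBond j x b = dist(B^j(x), b)/(L^kε)` (King's units), `Gc j x b = (L^kε)^{d−3}·|G^η_{(j)}(Γ^{(j+1)}_{x_{j+1},x}, b)|`
  (the vector-field slices are `A`-INDEPENDENT — abelian gauge field — so the background enters only `G`, `dG`); unit lemmas; ★★ `prop37PrintedAt_regV_of`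
  (transfer: Ζ-b's `Prop37PrintedAt α` for the scalar part ∧ `Ineq212` for the vector carrier ⇒ `Prop37PrintedAt α` for the full datum, constants
  `(max C C_v, min δ δ_v)`, `C ≥ 0`).
* §3 ★★★ **`prop37PrintedAt_king_regularField_vector`** — PROPOSITION 3.7, ALL THREE DISPLAYS, BY NAME AT A REGULAR BACKGROUND `A ≠ 0` on `T_ε`: `∃ K₀min K_v
  (1 ≤ K_v), ∀ α ∈ (0,1) ∃ t C δ₀ > 0, ∀ K₀ ≥ K₀min, ∀ cubic torus (Shape P, P.d = d, P.L = L) with K₀ ∣ M, 3K₀ ≤ 2M, K_v ∣ M, 3K_v ≤ 2M, ∀ 1 ≤ k ≤ K_P,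
  L^kε ≤ 1, ∀ A: |ΔA| ≤ δ_A, L^kδ_A|e| ≤ t: Prop37PrintedAt α (kingSliceKernelsRegV S C A m² a k μ₀² a_v) (C K₀) (δ₀ K₀)`; ★★★ `prop37KingOrder_king_flatField_vector`
  (every lattice-constant `A`), `prop37KingOrder_king_zeroField_vector`.

v1.1 (append-only, same seat): §4 — the THRESHOLD form of (2.10)∧(2.12) for the vector carrier (cube size freed) and the ONE-CUBE-SIZE editions
`prop37PrintedAt_king_regularField_vector′` ∕ `prop37KingOrder_king_flatField_vector′` with the non-vacuity witness `prop37_regularField_vector_family_nonempty`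
(the two-cube-size statements of §3 stay; on the cubic `Shape` tori their `K_v ∣ M` may be unsatisfiable when `K_v` is not a power of `L` — the primed
editions are the ones to cite).

HONEST SCOPE.  As PARTS Ζ-a∕b (block-norm reading; `Ω = T_ε`; constants per `(α, K₀)`; `m², μ₀² > 0`; cubic tori tiled by both cube sizes — jointly
satisfiable with `M` a large multiple of `K₀K_v`); the vector slices are Bałaban's (I.2.43) pieces of the `N = d` zero-charge torus propagator with
their own averaging constant `a_v` and mass `μ₀²` (King's gauge-field block spin (2.7)–(2.11) uses linear averaging of the abelian field: the same
operators at `U ≡ 1`).  NOT an η-rate; NE2⁺ for Bałaban's `G(U)` NOT proved; N15 NOT discharged.  Unit `pub-ymgap-dag-n15-e` g22 (R141 (C) s3), PART Ζ-d.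
-/

noncomputable section

open scoped BigOperators

namespace Summit.QuantumFields.YangMills.BalabanUVNodes.N15KingModelRung.RegularField

open Literature.MathematicalPhysics.QuantumFieldTheory.Balaban1983to89
open Literature.MathematicalPhysics.QuantumFieldTheory.Balaban1983to89.HiggsLattice (ChargeData)
open Literature.MathematicalPhysics.QuantumFieldTheory.Balaban1983to89.B3Sect2StatementsPart2 (ScaledKernels)
open Literature.MathematicalPhysics.QuantumFieldTheory.Balaban1983to89.B1Eq211ZeroFieldTorus (Shape)
open Literature.MathematicalPhysics.QuantumFieldTheory.Balaban1983to89.B1Ineq225BackgroundTorus (three_half_le_sites)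
open Literature.MathematicalPhysics.QuantumFieldTheory.Balaban1983to89.B3Ineq210RegularTorus (regTorusKernels mesh_eq_pow_mul)
open Literature.MathematicalPhysics.QuantumFieldTheory.Balaban1983to89.B3Ineq212VectorTorus (vecTorusKernels distBlockV distBlockV_nonneg scaleV_eq
  ineq210_and_212_vectorTorus)
open Literature.MathematicalPhysics.QuantumFieldTheory.King1986.SlicePropagator (SliceKernels holderDeriv Prop37PrintedAt Prop37KingOrder)
open Literature.MathematicalPhysics.QuantumFieldTheory.King1986 (ContinuumLimit.eps)

variable {P : HiggsLattice.Params} {N : ℕ}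

/-! ## §1 Monotonicity of `Prop37PrintedAt` in its constants -/

/-- one display of (3.63)–(3.65) is monotone in `(C, δ₀)`: `X ≤ C·S·e^{−δau}` with `S, a, u ≥ 0` ⇒ `X ≤ C′·S·e^{−δ′au}` for `C ≤ C′`, `0 ≤ C′`,
`δ′ ≤ δ`. [folklore] -/
private theorem display_weaken {X C C' S δ δ' a u : ℝ} (h : X ≤ C * S * Real.exp (-(δ * a * u))) (hS : 0 ≤ S) (ha : 0 ≤ a) (hu : 0 ≤ u)
    (hC : C ≤ C') (hC'0 : 0 ≤ C') (hδ : δ' ≤ δ) : X ≤ C' * S * Real.exp (-(δ' * a * u)) := by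
  have h1 : C * S * Real.exp (-(δ * a * u)) ≤ C' * S * Real.exp (-(δ * a * u)) :=
    mul_le_mul_of_nonneg_right (mul_le_mul_of_nonneg_right hC hS) (Real.exp_nonneg _)
  have hexp : Real.exp (-(δ * a * u)) ≤ Real.exp (-(δ' * a * u)) := by
    rw [Real.exp_le_exp]; nlinarith [mul_nonneg ha hu, mul_le_mul_of_nonneg_right hδ (mul_nonneg ha hu)]
  exact h.trans (h1.trans (mul_le_mul_of_nonneg_left hexp (mul_nonneg hC'0 hS)))

/-- **`Prop37PrintedAt` is monotone in its constants** (larger `C ≥ 0`, smaller rate `δ₀`) on data with positive slice lengths and non-negative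
distances. [cite: King1986, Prop 3.7 (3.63)–(3.65) p.663] -/
theorem prop37PrintedAt_weaken {d : ℕ} (D : SliceKernels d) (hs : ∀ j, 0 < D.slice j) (hdist : ∀ x y, 0 ≤ D.dist x y)
    (hdb : ∀ j x b, 0 ≤ D.distBlockBond j x b) {α C C' δ δ' : ℝ} (h : Prop37PrintedAt α D C δ) (hC : C ≤ C') (hC'0 : 0 ≤ C')
    (hδ : δ' ≤ δ) : Prop37PrintedAt α D C' δ' := by
  intro j hj
  obtain ⟨h63, h64, h65⟩ := h j hj
  have ha : 0 ≤ (D.slice j)⁻¹ := inv_nonneg.2 (hs j).le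
  refine ⟨fun x y => ⟨?_, fun μ => ?_⟩, fun x b => ?_, fun x y z hxy => ⟨?_, fun μ => ?_⟩⟩
  · exact display_weaken (h63 x y).1 (Real.rpow_nonneg (hs j).le _) ha (hdist x y) hC hC'0 hδ
  · exact display_weaken ((h63 x y).2 μ) (Real.rpow_nonneg (hs j).le _) ha (hdist x y) hC hC'0 hδ
  · exact display_weaken (h64 x b) (Real.rpow_nonneg (hs j).le _) ha (hdb j x b) hC hC'0 hδ
  · exact display_weaken ((h65 x y z hxy).1) (Real.rpow_nonneg (hs j).le _) ha (le_min (hdist x z) (hdist y z)) hC hC'0 hδ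
  · exact display_weaken ((h65 x y z hxy).2 μ) (Real.rpow_nonneg (hs j).le _) ha (le_min (hdist x z) (hdist y z)) hC hC'0 hδ

/-! ## §2 The datum with the vector-field slice clause -/

/-- ★ **KING's PROP-3.7 DATUM AT THE REGULAR BACKGROUND `A`, WITH THE (3.64) FIELD**: PART Ζ-b's `kingSliceKernelsReg S C A m² a k` with `B = PBond P 0`,
`distBlockBond j x b = dist(B^j(x), b)/(L^kε)`, `Gc j x b = (L^kε)^{d−3}·|G^η_{(j)}(Γ^{(j+1)}_{x_{j+1},x}, b)|` — the averaged kernel of the VECTOR-field slices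
(lit-balaban `vecTorusKernels _ μ₀² a_v k`, zero charge, `N = d`, `A`-independent) in King's units. [cite: King1986, Prop 3.7 (3.64) p.663, p.656 «vector field operators (of course with A = 0)»]
[cite: Balaban1983Higgs3, (2.12) p.426] -/
def kingSliceKernelsRegV (S : Shape P) (C : ChargeData N) (A : HiggsLattice.VecField P 0) (msq a : ℝ) (k : ℕ) (msqV aV : ℝ) :
    SliceKernels P.d where
  S := HiggsLattice.Site P 0
  B := HiggsLattice.PBond P 0
  dist x y := (HiggsLattice.Site.tdist x y : ℝ) / (P.L : ℝ) ^ k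
  distBlockBond j x b := distBlockV j x b / P.mesh k
  L := P.L
  k := k
  G j x y := P.mesh k ^ ((P.d : ℝ) - 2) * (regTorusKernels S C A msq a k).absG j x y
  dG j μ x y := P.mesh k ^ ((P.d : ℝ) - 1) * (regTorusKernels S C A msq a k).absDG j μ x y
  Gc j x b := P.mesh k ^ ((P.d : ℝ) - 3) * (vecTorusKernels S.hL.2 msqV aV k).absGavg j x b

section UnitsV

variable {S : Shape P} {C : ChargeData N} {A : HiggsLattice.VecField P 0} {msq a msqV aV : ℝ} {k : ℕ}

/-- the scalar part of the full datum IS PART Ζ-b's datum: same slices. [cite: King1986, Prop 3.7 p.663] -/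
theorem slice_regV (j : ℕ) : (kingSliceKernelsRegV S C A msq a k msqV aV).slice j = (kingSliceKernelsReg S C A msq a k).slice j := rfl

/-- same distance. [cite: King1986, Prop 3.7 p.663] -/
theorem dist_regV (x y : HiggsLattice.Site P 0) :
    (kingSliceKernelsRegV S C A msq a k msqV aV).dist x y = (kingSliceKernelsReg S C A msq a k).dist x y := rfl

/-- the vector carrier's averaged kernel is non-negative. [cite: Balaban1983Higgs3, (2.12) p.426] -/
theorem absGavg_nonneg (j : ℕ) (x : HiggsLattice.Site P 0) (b : HiggsLattice.PBond P 0) :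
    0 ≤ (vecTorusKernels S.hL.2 msqV aV k).absGavg j x b := by
  show 0 ≤ (P.mesh 0 ^ P.d)⁻¹ * |_|
  exact mul_nonneg (inv_nonneg.2 (pow_nonneg (P.mesh_pos 0).le _)) (abs_nonneg _)

/-- scaling: `(L^kε)^{d−3}·(L^jε)^{3−d} = (L^jη)^{3−d}` ((3.64)). [cite: King1986, (2.20) p.654, (3.64) p.663] -/
theorem scaling_three (j : ℕ) :
    P.mesh k ^ ((P.d : ℝ) - 3) * P.mesh j ^ ((3 : ℝ) - (P.d : ℝ))
      = ((kingSliceKernelsReg S C A msq a k).slice j) ^ ((3 : ℝ) - (P.d : ℝ)) := by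
  rw [slice_kingSliceKernelsReg, Real.div_rpow (P.mesh_pos j).le (P.mesh_pos k).le, div_eq_mul_inv, ← Real.rpow_neg (P.mesh_pos k).le,
    mul_comm]
  congr 1; congr 1; ring

/-- ★★ **TRANSFER**: `Prop37PrintedAt α` for the scalar datum at `(C, δ)`, `C ≥ 0`, and (2.12) for the vector carrier at `(δ_v, C_v)` give
`Prop37PrintedAt α` for the full datum at `(max C C_v, min δ δ_v)` (`C ≥ 0`). [cite: King1986, Prop 3.7 (3.63)–(3.65) p.663] [cite: Balaban1983Higgs3, (2.12) p.426] -/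
theorem prop37PrintedAt_regV_of {α Cs δ Cv δv : ℝ} (hCs : 0 ≤ Cs)
    (hS : Prop37PrintedAt α (kingSliceKernelsReg S C A msq a k) Cs δ)
    (hV : (vecTorusKernels S.hL.2 msqV aV k).Ineq212 δv Cv) :
    Prop37PrintedAt α (kingSliceKernelsRegV S C A msq a k msqV aV) (max Cs Cv) (min δ δv) := by
  have hmk : 0 < P.mesh k := P.mesh_pos k
  have hLk : (0 : ℝ) < (P.L : ℝ) ^ k := pow_pos (by exact_mod_cast P.hL) k
  have hmax0 : 0 ≤ max Cs Cv := hCs.trans (le_max_left _ _)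
  have hsl : ∀ j, 0 < (kingSliceKernelsReg S C A msq a k).slice j := fun j => by
    rw [slice_kingSliceKernelsReg]; exact div_pos (P.mesh_pos j) hmk
  have hdist : ∀ x y, 0 ≤ (kingSliceKernelsReg S C A msq a k).dist x y := fun x y =>
    div_nonneg (Nat.cast_nonneg _) hLk.le
  -- weaken the scalar part to the common constants (its `distBlockBond` is over `PEmpty`)
  have hS' : Prop37PrintedAt α (kingSliceKernelsReg S C A msq a k) (max Cs Cv) (min δ δv) :=
    prop37PrintedAt_weaken _ hsl hdist (fun _ _ b => b.elim) hS (le_max_left _ _) hmax0 (min_le_left _ _)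
  intro j hj
  obtain ⟨h63, _h64, h65⟩ := hS' j hj
  refine ⟨h63, fun x b => ?_, h65⟩
  -- (3.64) ⇐ (2.12) for the vector carrier, rescaled to King's units
  have hb := hV j x b
  rw [scaleV_eq] at hb
  have hdB : (vecTorusKernels S.hL.2 msqV aV k).distBlock j x b = distBlockV j x b := rfl
  have hdd : ((vecTorusKernels S.hL.2 msqV aV k).d : ℝ) = P.d := rfl
  rw [hdB, hdd] at hb
  show |P.mesh k ^ ((P.d : ℝ) - 3) * (vecTorusKernels S.hL.2 msqV aV k).absGavg j x b|
      ≤ max Cs Cv * ((kingSliceKernelsReg S C A msq a k).slice j) ^ ((3 : ℝ) - (P.d : ℝ))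
        * Real.exp (-(min δ δv * ((kingSliceKernelsReg S C A msq a k).slice j)⁻¹ * (distBlockV j x b / P.mesh k)))
  rw [abs_of_nonneg (mul_nonneg (Real.rpow_nonneg hmk.le _) (absGavg_nonneg (S := S) (msqV := msqV) (aV := aV) (k := k) j x b))]
  have hconv : ((kingSliceKernelsReg S C A msq a k).slice j)⁻¹ * (distBlockV j x b / P.mesh k) = (P.mesh j)⁻¹ * distBlockV j x b := by
    rw [slice_kingSliceKernelsReg]
    field_simp
  have hSnn : 0 ≤ P.mesh k ^ ((P.d : ℝ) - 3) * P.mesh j ^ ((3 : ℝ) - (P.d : ℝ)) :=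
    mul_nonneg (Real.rpow_nonneg hmk.le _) (Real.rpow_nonneg (P.mesh_pos j).le _)
  have h1 : P.mesh k ^ ((P.d : ℝ) - 3) * (vecTorusKernels S.hL.2 msqV aV k).absGavg j x b
      ≤ Cv * (P.mesh k ^ ((P.d : ℝ) - 3) * P.mesh j ^ ((3 : ℝ) - (P.d : ℝ))) * Real.exp (-(δv * (P.mesh j)⁻¹ * distBlockV j x b)) := by
    calc P.mesh k ^ ((P.d : ℝ) - 3) * (vecTorusKernels S.hL.2 msqV aV k).absGavg j x b
        ≤ P.mesh k ^ ((P.d : ℝ) - 3) * (Cv * P.mesh j ^ ((3 : ℝ) - (P.d : ℝ)) * Real.exp (-(δv * (P.mesh j)⁻¹ * distBlockV j x b))) :=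
          mul_le_mul_of_nonneg_left hb (Real.rpow_nonneg hmk.le _)
      _ = _ := by ring
  have h2 := display_weaken h1 hSnn (inv_nonneg.2 (P.mesh_pos j).le) (distBlockV_nonneg j x b) (le_max_right Cs Cv) hmax0
    (min_le_right δ δv)
  rw [scaling_three] at h2
  rw [mul_assoc (min δ δv), hconv, ← mul_assoc]
  exact h2

end UnitsV

/-! ## §3 Proposition 3.7, all three displays, BY NAME at a regular background -/

section MainV

/-- ★★★ **KING 1986 PROPOSITION 3.7 — (3.63), (3.64), (3.65) ALL INHABITED — BY NAME AT A REGULAR BACKGROUND `A ≠ 0`, `Ω = T_ε`, KING's ORDER**: scalar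
slices at the live field (PART Ζ-b ⇐ p26's [Ba3] (2.10)∕(2.11)), vector-field slices from [Ba3] (2.12) (`ineq210_and_212_vectorTorus`); cubic tori tiled
by both cube sizes `K₀` (scalar, `≥ K₀min`) and `K_v` (vector). [cite: King1986, Prop 3.7 (3.63)–(3.65) p.663, p.656, p.665]
[cite: Balaban1983Higgs3, (2.10)–(2.12) p.426] [cite: Balaban1982Higgs1, (2.43) p.612] -/
theorem prop37PrintedAt_king_regularField_vector (d L : ℕ) (hd : 1 ≤ d) (hL : Odd L ∧ 1 < L) {a msq aV msqV : ℝ} (ha : 0 < a)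
    (hmsq : 0 < msq) (haV : 0 < aV) (hmsqV : 0 < msqV) (N : ℕ) (C : ChargeData N) :
    ∃ K₀min Kv : ℕ, 1 ≤ Kv ∧ ∀ {α : ℝ}, 0 < α → α < 1 →
      ∃ t Cst δ₀ : ℕ → ℝ, (∀ K₀, 0 < t K₀ ∧ 0 < Cst K₀ ∧ 0 < δ₀ K₀) ∧
      ∀ K₀ : ℕ, K₀min ≤ K₀ →
      ∀ (P : HiggsLattice.Params) (S : Shape P), P.d = d → P.L = L → K₀ ∣ P.M → 3 * K₀ ≤ 2 * P.M → Kv ∣ P.M → 3 * Kv ≤ 2 * P.M →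
      ∀ {k : ℕ}, 1 ≤ k → k ≤ P.K → P.mesh k ≤ 1 →
      ∀ (A : HiggsLattice.VecField P 0) {δA : ℝ}, 0 ≤ δA →
        (∀ (z : HiggsLattice.Site P 0) (μ ν : Fin P.d), |A ⟨z.shift ν, μ⟩ - A ⟨z, μ⟩| ≤ δA) →
        (P.L : ℝ) ^ k * δA * |C.e| ≤ t K₀ →
        Prop37PrintedAt α (kingSliceKernelsRegV S C A msq a k msqV aV) (Cst K₀) (δ₀ K₀) := by
  have hL2 : 2 ≤ L := hL.2
  obtain ⟨K₀min, hS⟩ := prop37PrintedAt_king_regularField d L hL ha hmsq N C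
  obtain ⟨Kv, hKv1, δv, Cv, hδv, hCv, hV⟩ := ineq210_and_212_vectorTorus d L hd hL2 haV hmsqV
  refine ⟨K₀min, Kv, hKv1, fun {α} hα0 hα1 => ?_⟩
  obtain ⟨t, Cst, δ₀, hpos, hS'⟩ := hS hα0 hα1
  refine ⟨t, fun K₀ => max (Cst K₀) Cv, fun K₀ => min (δ₀ K₀) δv,
    fun K₀ => ⟨(hpos K₀).1, lt_max_of_lt_left (hpos K₀).2.1, lt_min (hpos K₀).2.2 hδv⟩, ?_⟩
  intro K₀ hK₀ P S hPd hPL hK₀M h3M hKvM h3v k hk1 hkK hmesh A δA hδA hreg ht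
  have h1 := hS' K₀ hK₀ P S hPd hPL hK₀M h3M hk1 hkK hmesh A hδA hreg ht
  have h2 := (hV P S.hL.2 hPd hPL hKvM hk1 hkK (fun μ => three_half_le_sites hkK h3v μ) hmesh).2
  exact prop37PrintedAt_regV_of (hpos K₀).2.1.le h1 h2

/-- ★★★ **`Prop37KingOrder` — ALL THREE DISPLAYS — AT EVERY LATTICE-CONSTANT (FLAT) BACKGROUND `A`** on the cubic tori tiled by both cube sizes.
[cite: King1986, Prop 3.7 p.663] [cite: Balaban1983Higgs3, (2.10)–(2.12) p.426] -/
theorem prop37KingOrder_king_flatField_vector (d L : ℕ) (hd : 1 ≤ d) (hL : Odd L ∧ 1 < L) {a msq aV msqV : ℝ} (ha : 0 < a)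
    (hmsq : 0 < msq) (haV : 0 < aV) (hmsqV : 0 < msqV) (N : ℕ) (C : ChargeData N) :
    ∃ K₀min Kv : ℕ, 1 ≤ Kv ∧ ∀ K₀ : ℕ, K₀min ≤ K₀ →
      ∀ (P : HiggsLattice.Params) (S : Shape P), P.d = d → P.L = L → K₀ ∣ P.M → 3 * K₀ ≤ 2 * P.M → Kv ∣ P.M → 3 * Kv ≤ 2 * P.M →
      ∀ {k : ℕ}, 1 ≤ k → k ≤ P.K → P.mesh k ≤ 1 →
      ∀ (A : HiggsLattice.VecField P 0), (∀ (z : HiggsLattice.Site P 0) (μ ν : Fin P.d), A ⟨z.shift ν, μ⟩ = A ⟨z, μ⟩) →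
        Prop37KingOrder (kingSliceKernelsRegV S C A msq a k msqV aV) := by
  obtain ⟨K₀min, Kv, hKv1, h⟩ := prop37PrintedAt_king_regularField_vector d L hd hL ha hmsq haV hmsqV N C
  refine ⟨K₀min, Kv, hKv1, fun K₀ hK₀ P S hPd hPL hK₀M h3M hKvM h3v k hk1 hkK hmesh A hflat α hα0 hα1 => ?_⟩
  obtain ⟨t, Cst, δ₀, hpos, h'⟩ := h hα0 hα1
  refine ⟨Cst K₀, δ₀ K₀, (hpos K₀).2.2, ?_⟩
  refine h' K₀ hK₀ P S hPd hPL hK₀M h3M hKvM h3v hk1 hkK hmesh A (δA := 0) le_rfl (fun z μ ν => ?_) ?_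
  · rw [hflat z μ ν, sub_self, abs_zero]
  · rw [mul_zero, zero_mul]; exact (hpos K₀).1.le

/-- **The member `A = 0`, all three displays.** [cite: King1986, Prop 3.7 p.663] [cite: Balaban1983Higgs3, (2.10)–(2.12) p.426] -/
theorem prop37KingOrder_king_zeroField_vector (d L : ℕ) (hd : 1 ≤ d) (hL : Odd L ∧ 1 < L) {a msq aV msqV : ℝ} (ha : 0 < a)
    (hmsq : 0 < msq) (haV : 0 < aV) (hmsqV : 0 < msqV) (N : ℕ) (C : ChargeData N) :
    ∃ K₀min Kv : ℕ, 1 ≤ Kv ∧ ∀ K₀ : ℕ, K₀min ≤ K₀ →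
      ∀ (P : HiggsLattice.Params) (S : Shape P), P.d = d → P.L = L → K₀ ∣ P.M → 3 * K₀ ≤ 2 * P.M → Kv ∣ P.M → 3 * Kv ≤ 2 * P.M →
      ∀ {k : ℕ}, 1 ≤ k → k ≤ P.K → P.mesh k ≤ 1 →
        Prop37KingOrder (kingSliceKernelsRegV S C (0 : HiggsLattice.VecField P 0) msq a k msqV aV) := by
  obtain ⟨K₀min, Kv, hKv1, h⟩ := prop37KingOrder_king_flatField_vector d L hd hL ha hmsq haV hmsqV N C
  exact ⟨K₀min, Kv, hKv1, fun K₀ hK₀ P S hPd hPL hK₀M h3M hKvM h3v k hk1 hkK hmesh =>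
    h K₀ hK₀ P S hPd hPL hK₀M h3M hKvM h3v hk1 hkK hmesh 0 fun _ _ _ => rfl⟩

end MainV

/-! ## §4 (v1.1) ONE CUBE SIZE: the threshold form of [Ba3] (2.10)∧(2.12) for the vector carrier, and Prop 3.7 (all displays) on the SAME
cubic tori as PART Ζ-b — non-vacuity explicit

The `K_v` of `ineq210_and_212_vectorTorus` is a fixed integer; on the cubic `Shape` tori (`M·L′_μ = L^m`) the condition `K_v ∣ M` may be
unsatisfiable when `K_v` is not a power of `L`.  The source behind it (r14 `B3Ineq210RegularRegion.ineq210_regularRegion_explicit`) is in THRESHOLD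
form, so (2.10)∧(2.12) hold for EVERY cube size above a threshold; with one cube size for both parts the hypotheses are those of PART Ζ-b, met by
lit-balaban p26's witness `regularTorus_hypotheses_nonvacuous`. -/

section Threshold

open Literature.MathematicalPhysics.QuantumFieldTheory.Balaban1983to89.B3MultiscaleFields (zeroCharge)
open Literature.MathematicalPhysics.QuantumFieldTheory.Balaban1983to89.B3Ineq210RegularRegion (Interior ineq210_regularRegion_explicit)
open Literature.MathematicalPhysics.QuantumFieldTheory.Balaban1983to89.B1TorusRegionHSizes (isBigBlockUnion_univ)
open Literature.MathematicalPhysics.QuantumFieldTheory.Balaban1983to89.B1TorusCubeCover (half)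
open Literature.MathematicalPhysics.QuantumFieldTheory.Balaban1983to89.B3Ineq212VectorTorus (ineq210_212_of_bounds)
open Literature.MathematicalPhysics.QuantumFieldTheory.Balaban1983to89.B3Ineq210RegularTorus (regularTorus_hypotheses_nonvacuous)

/-- **[Ba3] (2.10) ∧ (2.12) FOR THE VECTOR-FIELD CARRIER, THRESHOLD FORM**: for `d ≥ 1`, `L ≥ 2`, `a_v, μ₀² > 0` there is `K₀min` such that for EVERY cube size
`K₀ ≥ K₀min` there are `δ₁, C > 0` with `Ineq210 δ₁ C ∧ Ineq212 δ₁ C` for `vecTorusKernels _ μ₀² a_v k` on every volume with `P.d = d`, `P.L = L`, `K₀ ∣ M`,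
every `1 ≤ k ≤ K_P` with `3L^kK₀ ≤ |T_ε|_μ`, `L^kε ≤ 1` — lit-balaban's `ineq210_and_212_vectorTorus` with the cube size freed (same three-line route:
r14's region theorem at `Ω = T_ε`, `A = 0`, zero charge; `ineq210_212_of_bounds`). [cite: Balaban1983Higgs3, (2.10), (2.12) p.426] [cite: Balaban1982Higgs1, Prop. 2.1 p.610] -/
theorem ineq210_and_212_vectorTorus_threshold (d L : ℕ) (hd : 1 ≤ d) (hL : 2 ≤ L) {aV : ℝ} (haV : 0 < aV) {msqV : ℝ} (hmsqV : 0 < msqV) :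
    ∃ K₀min : ℕ, ∀ K₀ : ℕ, K₀min ≤ K₀ → ∃ δ₁ Cv : ℝ, 0 < δ₁ ∧ 0 < Cv ∧
      ∀ (P : HiggsLattice.Params) (hP1 : 1 < P.L), P.d = d → P.L = L → K₀ ∣ P.M →
      ∀ {k : ℕ}, 1 ≤ k → k ≤ P.K → (∀ μ, 3 * half P k K₀ ≤ P.sitesPerDir 0 μ) → P.mesh k ≤ 1 →
        (vecTorusKernels hP1 msqV aV k).Ineq210 δ₁ Cv ∧ (vecTorusKernels hP1 msqV aV k).Ineq212 δ₁ Cv := by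
  obtain ⟨E₀, hE₀, h⟩ := ineq210_regularRegion_explicit d L hd hL haV hmsqV (c := 0) le_rfl d
  have he : (zeroCharge d).e ^ 2 ≤ E₀ := by
    rw [show (zeroCharge d).e = 0 from rfl]
    simpa using hE₀.le
  obtain ⟨K₀min, h⟩ := h (zeroCharge d) he
  refine ⟨K₀min, fun K₀ hK₀ => ?_⟩
  obtain ⟨t, δ₁, Cst, ht, hδ₁, hCst, h⟩ := h K₀ hK₀
  have hL0 : (0 : ℝ) < L := by exact_mod_cast (by omega : 0 < L)
  refine ⟨δ₁, Cst * (1 + (d : ℝ) * (L : ℝ) * Real.exp (δ₁ * L)), hδ₁, by positivity, ?_⟩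
  intro P hP1 hPd hPL hK₀M k hk1 hkK h3 hmesh
  subst hPd hPL
  have hint : ∀ x : HiggsLattice.Site P 0, Interior k K₀ (Finset.univ : Finset (HiggsLattice.Site P 0)) x :=
    fun x y _ => Finset.mem_univ y
  have hreg : ∀ z ∈ (Finset.univ : Finset (HiggsLattice.Site P 0)), ∀ μ ν : Fin P.d,
      |(0 : HiggsLattice.VecField P 0) ⟨z.shift ν, μ⟩ - (0 : HiggsLattice.VecField P 0) ⟨z, μ⟩| ≤ 0 := by
    intro z _ μ ν
    simp
  have ht' : (P.L : ℝ) ^ k * 0 * |(zeroCharge P.d).e| ≤ t := by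
    rw [mul_zero, zero_mul]; exact ht.le
  have hc' : (P.L : ℝ) ^ k * 0 ≤ 0 * |(zeroCharge P.d).e| := by rw [mul_zero, zero_mul]
  have hK := h P hP1 rfl rfl hK₀M hk1 hkK h3 hmesh Finset.univ isBigBlockUnion_univ (0 : HiggsLattice.VecField P 0) le_rfl hreg ht' hc'
  have hboth := ineq210_212_of_bounds (hL1 := hP1) (msq := msqV) (a := aV) hk1 hkK hδ₁ hCst.le
    (fun j z y => (hK j z y (hint z) (hint y)).1) (fun j μ z y => (hK j z y (hint z) (hint y)).2 μ)
  -- weaken both constants to the common one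
  have hsc : ∀ j, 0 < (vecTorusKernels hP1 msqV aV k).scale j := fun j => by rw [scaleV_eq]; exact P.mesh_pos j
  have h1 : Cst ≤ Cst * (1 + (P.d : ℝ) * (P.L : ℝ) * Real.exp (δ₁ * P.L)) := by
    have : (1 : ℝ) ≤ 1 + (P.d : ℝ) * (P.L : ℝ) * Real.exp (δ₁ * P.L) := by
      have : 0 ≤ (P.d : ℝ) * (P.L : ℝ) * Real.exp (δ₁ * P.L) := by positivity
      linarith
    nlinarith
  have h2 : (P.d : ℝ) * (P.L : ℝ) * Real.exp (δ₁ * P.L) * Cst ≤ Cst * (1 + (P.d : ℝ) * (P.L : ℝ) * Real.exp (δ₁ * P.L)) := by nlinarith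
  refine ⟨fun j x x' => ?_, fun j x b => ?_⟩
  · obtain ⟨hv, hdv⟩ := hboth.1 j x x'
    exact ⟨hv.trans (mul_le_mul_of_nonneg_right (mul_le_mul_of_nonneg_right h1 (Real.rpow_nonneg (hsc j).le _)) (Real.exp_nonneg _)),
      fun μ => (hdv μ).trans (mul_le_mul_of_nonneg_right (mul_le_mul_of_nonneg_right h1 (Real.rpow_nonneg (hsc j).le _)) (Real.exp_nonneg _))⟩
  · exact (hboth.2 j x b).trans
      (mul_le_mul_of_nonneg_right (mul_le_mul_of_nonneg_right h2 (Real.rpow_nonneg (hsc j).le _)) (Real.exp_nonneg _))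

/-- ★★★ **KING 1986 PROPOSITION 3.7 — ALL THREE DISPLAYS — BY NAME AT A REGULAR BACKGROUND, ONE CUBE SIZE** (v1.1, the form to cite): the hypotheses
are EXACTLY those of PART Ζ-b's `prop37PrintedAt_king_regularField` (cubic torus of r14's sub-family, `K₀ ≥ K₀min`, `K₀ ∣ M`, `3K₀ ≤ 2M`, `1 ≤ k ≤ K_P`,
`L^kε ≤ 1`, `A` with one-step differences `≤ δ_A`, `L^kδ_A|e| ≤ t(K₀)`), hence non-vacuous (`prop37_regularField_vector_family_nonempty`).
[cite: King1986, Prop 3.7 (3.63)–(3.65) p.663, p.656, p.665] [cite: Balaban1983Higgs3, (2.10)–(2.12) p.426] [cite: Balaban1982Higgs1, (2.43) p.612] -/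
theorem prop37PrintedAt_king_regularField_vector' (d L : ℕ) (hd : 1 ≤ d) (hL : Odd L ∧ 1 < L) {a msq aV msqV : ℝ} (ha : 0 < a)
    (hmsq : 0 < msq) (haV : 0 < aV) (hmsqV : 0 < msqV) (N : ℕ) (C : ChargeData N) :
    ∃ K₀min : ℕ, ∀ {α : ℝ}, 0 < α → α < 1 →
      ∃ t Cst δ₀ : ℕ → ℝ, (∀ K₀, 0 < t K₀ ∧ 0 < Cst K₀ ∧ 0 < δ₀ K₀) ∧
      ∀ K₀ : ℕ, K₀min ≤ K₀ →
      ∀ (P : HiggsLattice.Params) (S : Shape P), P.d = d → P.L = L → K₀ ∣ P.M → 3 * K₀ ≤ 2 * P.M →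
      ∀ {k : ℕ}, 1 ≤ k → k ≤ P.K → P.mesh k ≤ 1 →
      ∀ (A : HiggsLattice.VecField P 0) {δA : ℝ}, 0 ≤ δA →
        (∀ (z : HiggsLattice.Site P 0) (μ ν : Fin P.d), |A ⟨z.shift ν, μ⟩ - A ⟨z, μ⟩| ≤ δA) →
        (P.L : ℝ) ^ k * δA * |C.e| ≤ t K₀ →
        Prop37PrintedAt α (kingSliceKernelsRegV S C A msq a k msqV aV) (Cst K₀) (δ₀ K₀) := by
  have hL2 : 2 ≤ L := hL.2
  obtain ⟨K₁, hS⟩ := prop37PrintedAt_king_regularField d L hL ha hmsq N C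
  obtain ⟨K₂, hV⟩ := ineq210_and_212_vectorTorus_threshold d L hd hL2 haV hmsqV
  -- choose the vector constants as functions of the cube size (above the threshold; junk `1` below)
  classical
  have hVf : ∃ δv Cv : ℕ → ℝ, (∀ K₀, 0 < δv K₀ ∧ 0 < Cv K₀) ∧ ∀ K₀, K₂ ≤ K₀ →
      ∀ (P : HiggsLattice.Params) (hP1 : 1 < P.L), P.d = d → P.L = L → K₀ ∣ P.M →
      ∀ {k : ℕ}, 1 ≤ k → k ≤ P.K → (∀ μ, 3 * half P k K₀ ≤ P.sitesPerDir 0 μ) → P.mesh k ≤ 1 →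
        (vecTorusKernels hP1 msqV aV k).Ineq212 (δv K₀) (Cv K₀) := by
    refine ⟨fun K₀ => if h : K₂ ≤ K₀ then Classical.choose (hV K₀ h) else 1,
      fun K₀ => if h : K₂ ≤ K₀ then Classical.choose (Classical.choose_spec (hV K₀ h)) else 1, fun K₀ => ?_, fun K₀ hK₀ => ?_⟩
    · by_cases h : K₂ ≤ K₀
      · have hs := Classical.choose_spec (Classical.choose_spec (hV K₀ h))
        simp only [dif_pos h]
        exact ⟨hs.1, hs.2.1⟩
      · simp only [dif_neg h]; exact ⟨one_pos, one_pos⟩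
    · have hs := Classical.choose_spec (Classical.choose_spec (hV K₀ hK₀))
      simp only [dif_pos hK₀]
      intro P hP1 hPd hPL hK₀M k hk1 hkK h3 hmesh
      exact (hs.2.2 P hP1 hPd hPL hK₀M hk1 hkK h3 hmesh).2
  obtain ⟨δv, Cv, hvpos, hV'⟩ := hVf
  refine ⟨max K₁ K₂, fun {α} hα0 hα1 => ?_⟩
  obtain ⟨t, Cst, δ₀, hpos, hS'⟩ := hS hα0 hα1
  refine ⟨t, fun K₀ => max (Cst K₀) (Cv K₀), fun K₀ => min (δ₀ K₀) (δv K₀),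
    fun K₀ => ⟨(hpos K₀).1, lt_max_of_lt_left (hpos K₀).2.1, lt_min (hpos K₀).2.2 (hvpos K₀).1⟩, ?_⟩
  intro K₀ hK₀ P S hPd hPL hK₀M h3M k hk1 hkK hmesh A δA hδA hreg ht
  have h1 := hS' K₀ ((le_max_left _ _).trans hK₀) P S hPd hPL hK₀M h3M hk1 hkK hmesh A hδA hreg ht
  have h2 := hV' K₀ ((le_max_right _ _).trans hK₀) P S.hL.2 hPd hPL hK₀M hk1 hkK (fun μ => three_half_le_sites hkK h3M μ) hmesh
  exact prop37PrintedAt_regV_of (hpos K₀).2.1.le h1 h2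

/-- ★★★ **`Prop37KingOrder` — all three displays — at every lattice-constant (flat) background, ONE CUBE SIZE** (v1.1). [cite: King1986, Prop 3.7 p.663]
[cite: Balaban1983Higgs3, (2.10)–(2.12) p.426] -/
theorem prop37KingOrder_king_flatField_vector' (d L : ℕ) (hd : 1 ≤ d) (hL : Odd L ∧ 1 < L) {a msq aV msqV : ℝ} (ha : 0 < a)
    (hmsq : 0 < msq) (haV : 0 < aV) (hmsqV : 0 < msqV) (N : ℕ) (C : ChargeData N) :
    ∃ K₀min : ℕ, ∀ K₀ : ℕ, K₀min ≤ K₀ →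
      ∀ (P : HiggsLattice.Params) (S : Shape P), P.d = d → P.L = L → K₀ ∣ P.M → 3 * K₀ ≤ 2 * P.M →
      ∀ {k : ℕ}, 1 ≤ k → k ≤ P.K → P.mesh k ≤ 1 →
      ∀ (A : HiggsLattice.VecField P 0), (∀ (z : HiggsLattice.Site P 0) (μ ν : Fin P.d), A ⟨z.shift ν, μ⟩ = A ⟨z, μ⟩) →
        Prop37KingOrder (kingSliceKernelsRegV S C A msq a k msqV aV) := by
  obtain ⟨K₀min, h⟩ := prop37PrintedAt_king_regularField_vector' d L hd hL ha hmsq haV hmsqV N C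
  refine ⟨K₀min, fun K₀ hK₀ P S hPd hPL hK₀M h3M k hk1 hkK hmesh A hflat α hα0 hα1 => ?_⟩
  obtain ⟨t, Cst, δ₀, hpos, h'⟩ := h hα0 hα1
  refine ⟨Cst K₀, δ₀ K₀, (hpos K₀).2.2, ?_⟩
  refine h' K₀ hK₀ P S hPd hPL hK₀M h3M hk1 hkK hmesh A (δA := 0) le_rfl (fun z μ ν => ?_) ?_
  · rw [hflat z μ ν, sub_self, abs_zero]
  · rw [mul_zero, zero_mul]; exact (hpos K₀).1.le

/-- **NON-VACUITY + EXHIBIT** (v1.1): above the threshold there are a cube size, a cubic torus and a level (`k = 1`) meeting every hypothesis of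
`prop37KingOrder_king_flatField_vector'`, on which `Prop37KingOrder (kingSliceKernelsRegV S C 0 m² a 1 μ₀² a_v)` holds — the three displays of King's
Prop 3.7 for the member `A = 0`. [cite: King1986, Prop 3.7 p.663] [cite: Balaban1982Higgs1, (1.2) p.604] -/
theorem prop37_regularField_vector_family_nonempty (d L : ℕ) (hd : 1 ≤ d) (hL : Odd L ∧ 1 < L) {a msq aV msqV : ℝ} (ha : 0 < a)
    (hmsq : 0 < msq) (haV : 0 < aV) (hmsqV : 0 < msqV) (N : ℕ) (C : ChargeData N) :
    ∃ (K₀ : ℕ) (P : HiggsLattice.Params) (S : Shape P), P.d = d ∧ P.L = L ∧ K₀ ∣ P.M ∧ 3 * K₀ ≤ 2 * P.M ∧ 1 ≤ P.K ∧ P.mesh 1 ≤ 1 ∧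
      Prop37KingOrder (kingSliceKernelsRegV S C (0 : HiggsLattice.VecField P 0) msq a 1 msqV aV) := by
  obtain ⟨K₀min, h⟩ := prop37KingOrder_king_flatField_vector' d L hd hL ha hmsq haV hmsqV N C
  obtain ⟨K₀, hK₀, P, S, hPd, hPL, hK₀M, h3M, hK1, hmesh⟩ := regularTorus_hypotheses_nonvacuous d L hd hL K₀min
  exact ⟨K₀, P, S, hPd, hPL, hK₀M, h3M, hK1, hmesh, h K₀ hK₀ P S hPd hPL hK₀M h3M le_rfl hK1 hmesh 0 fun _ _ _ => rfl⟩

end Threshold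

end Summit.QuantumFields.YangMills.BalabanUVNodes.N15KingModelRung.RegularField

end
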